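/-
COR-CM (cell pub-hodgecm2, stage 2 of the Hodge ladder) — junction B01 `PerLFace_of_PerL`: the ∃-MEET FORM of the coupling /
overlap leg (B01-O).  AUTHORED AND FILED by prover-pub-hodgecm2-b01-x1-0 (extra prover under the single owner of B01,
`pub-hodgecm2-own-b01`; path `CorCM/B01/FaceWedgeMeet.lean` reserved by own-b01, HOME/INBOX l.4144, and named for this seat by the
lead's NAMING RULING l.4194 (3); sketch of record md5 4a49a9e42192, 2026-08-21).  Two `@[conjecture]` definitions (`FaceWedgeMeet`, a
displayed face-scoped residual, NOT asserted; `FaceWedgePairing`, proved EQUIVALENT to `PeriodThmF`, so not an input) and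
theorems; nothing cited as a record; `Interfaces.lean` (C1), the E term and the other `CorCM/B01/*` files untouched.
FRAMING (COORDINATOR RULING 2026-08-21T11:55:35Z): `HC_CM` is NOT proved; no declaration below inhabits any displayed hypothesis.

  `FaceWedgeMeet U` : for every face datum `(F, f, ι₁, V)` there are a level `Γ` and a NON-ZERO class `x ∈ H²(P_Γ, ℂ)` lying
  in BOTH wedge spans `W₀₁(Γ) = ⟨ω₀ ∪ ω₁ : ωᵢ ∈ U_{Ψᵢ}(Γ)⟩` and `W₂₃(Γ)` (`Universe.wedgeSpan`, `B01/FaceInputsSplit.lean:86`)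
  — PerL v5's «S₁₂ ∩ S₃₄ ≠ 0» read on cohomology at one finite level (weaker than Thm 3.7 «S₁₂ = S₃₄»; no Hecke span, no
  ∀ over `(Γ, ω₀, ω₁)`; the form recommended by pub-hodgecm2-b01-idea-2 g11, hodge-director/INBOX l.344).

  * `periodThmF_of_faceWedgeMeet` — `FaceWedgeMeet → PeriodThmF` on any universe with `Fact_pull_hodge`, `Fact_cup2_hodge` and
    Hodge–Riemann (2,0) on its Picard modular surfaces (`⟨x, x⟩ ≠ 0`, expansion of both slots of the pairing over pure wedges,
    `periodNV_of_period_ne_zero`); on the model universe HR is the tree theorem `Model.universeOf_hodgeRiemann_pms`, so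
    **`Model.perLFace_of_PerL_of_faceWedgeMeet : (∀ data, FaceWedgeMeet (U_rec)) → PerLFace_of_PerL`** — a ONE-LEAF displayed form.
  * `faceWedgeMeet_of_faceLineField_of_wedgeOverlap`, `faceWedgeMeet_of_supply_heckeWedge10_overlap` — the leaf is IMPLIED by the
    splits of record (B01-L ∧ B01-O, resp. B01-S ∧ B01-H ∧ B01-O; `heckeSpan ≤ wedgeSpan` by `Fact_pull_comp`, `Fact_pull_cup`).
  * `faceLineField_of_faceWedgeMeet`, `faceSupply_of_faceWedgeMeet` — it implies B01-L and B01-S (a non-zero element of a span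
    has a non-zero generator), hence it is FALSE on the PerL shadow (`not_faceWedgeMeet_perLShadow`,
    `not_forall_perL_imp_faceWedgeMeet`): an honest, non-vacuous leaf carrying the model-specific content (unlike B01-O, which is
    vacuously true on the shadow, `FaceInputsSplitNonVacuity.lean`).
  * `FaceWedgePairing` / `faceWedgePairing_iff_periodThmF` (hypothesis-free, every universe) — the PAIRING form of the wedge-span
    statement is `PeriodThmF` itself; `faceWedgePairing_of_faceWedgeMeet` (HR).  So `FaceWedgeMeet` is a SUFFICIENT one-leaf form
    strictly between the split of record and the target, NOT the statement the socket path (`FaceThetaDatum`,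
    `B01/ThetaRealisationSocket.lean:66`, whose engine yields a non-zero PAIRING; `Transposition.faceThetaDataExists_iff_wedgeMeet`,
    `Transposition/Item6HoldsRec.lean`) delivers: deriving MEET from an `L²` coupling needs a finite-level descent (K_Γ-projection of
    the closed (23)-span into ONE level), i.e. PerL Lemma 3.5 at a FIXED level.
-/
import Summits.HodgeConjecture.CorCM.B01.FaceInputsSplitNonVacuity
import HarnessLib

/-!
# B01-O in ∃-meet form: `FaceWedgeMeet`, `FaceWedgePairing ↔ PeriodThmF`, and B01 from the one leaf

Contents (namespace `Summit.HodgeConjecture.CorCM`):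
* `Universe.FaceWedgeMeet` — at one level the (01)- and (23)-wedge spans of `U_Ψ`-classes meet non-trivially (displayed).
* `Universe.periodNV_of_wedgeMeet`, `Universe.periodThmF_of_faceWedgeMeet` — MEET ⇒ `PeriodThmF` under `Fact_pull_hodge`,
  `Fact_cup2_hodge`, Hodge–Riemann (2,0).
* `Universe.faceWedgeMeet_of_faceLineField_of_wedgeOverlap`, `Universe.faceWedgeMeet_of_supply_heckeWedge10_overlap`,
  `Universe.faceLineField_of_faceWedgeMeet`, `Universe.faceSupply_of_faceWedgeMeet`,
  `Universe.faceWedgeMeet_iff_faceLineField_of_wedgeOverlap` — position relative to the S/H/O split of `FaceInputsSplit.lean`.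
* `Universe.FaceWedgePairing`, `Universe.periodNV_of_wedgePairing`, `Universe.faceWedgePairing_iff_periodThmF`
  (hypothesis-free), `Universe.faceWedgePairing_of_faceWedgeMeet`.
* `Universe.not_faceWedgeMeet_perLShadow`, `exists_perL_perL44_not_faceWedgeMeet`, `not_forall_perL_imp_faceWedgeMeet` —
  vacuity discipline (the leaf is false on the PerL shadow).
* `Model.universeOf_periodThmF_of_faceWedgeMeet`, `Model.perLFace_of_PerL_of_faceWedgeMeet`,
  `Model.perLFace_closed_of_faceWedgeMeet`, `Model.universeOf_faceWedgeMeet_of_supply_heckeWedge10_overlap` — the model side.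
-/

noncomputable section

open scoped TensorProduct

namespace Summit.HodgeConjecture.CorCM

open Literature.AlgebraicGeometry.Motives (CMType HodgeStructure)
open Literature.AlgebraicGeometry.Motives.HodgeStructure (EndAction conj)

namespace Universe

variable (U : Universe)

/-- **FaceWedgeMeet** (PerL v5 «`S₁₂ ∩ S₃₄ ≠ 0`» at one finite level, face-transposed and read on cohomology): for every
Galois CM field `F` with `6 ≤ [F:ℚ]`, every rank-four face `f` with admissible `ι₁` and every hermitian 3-space `V`, there are
a torsion-free congruence level `Γ` and a non-zero class `x ∈ H²(P_Γ, ℂ)` that is at the same time a combination of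
(01)-wedges `ω₀ ∪ ω₁` (`ωᵢ ∈ U_{Ψᵢ}(Γ)`, `Ψ = f.psi`) and a combination of (23)-wedges `ω₂ ∪ ω₃`.  Displayed face-scoped
residual input of binder B01; not asserted. -/
@[conjecture]
def FaceWedgeMeet : Prop :=
  ∀ (F : CMField), IsGalois ℚ F → 6 ≤ Module.finrank ℚ F →
    ∀ (f : Face F) (ι₁ : F →+* ℂ), f.Admissible ι₁ →
    ∀ V : HermSpace3 F ι₁, ∃ (Γ : Level V) (x : U.CohC (U.pms F ι₁ V Γ) 2), x ≠ 0 ∧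
      x ∈ U.wedgeSpan Γ F (f.psi 0) (f.psi 1) ι₁ ∧ x ∈ U.wedgeSpan Γ F (f.psi 2) (f.psi 3) ι₁

variable {U}

/-! ### The pairing `⟨y, z⟩ := tr(y ∪ conj z)` on `H²(P, ℂ)`: conjugate-linear in `z` -/

/-- The pairing `tr(y ∪ conj z)` is additive and conjugate-homogeneous in `z` (the two side conditions of
`exists_mem_ne_zero_of_span` for the right slot). [folklore] -/
theorem trC_cup2C_conj_add_smul (X : U.Var) (y : U.CohC X 2) :
    (∀ z z' : U.CohC X 2, U.trC X 4 (U.cup2C X 2 y (conj (z + z'))) =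
      U.trC X 4 (U.cup2C X 2 y (conj z)) + U.trC X 4 (U.cup2C X 2 y (conj z'))) ∧
    (∀ (c : ℂ) (z : U.CohC X 2), ∃ c' : ℂ,
      U.trC X 4 (U.cup2C X 2 y (conj (c • z))) = c' * U.trC X 4 (U.cup2C X 2 y (conj z))) :=
  ⟨fun z z' => by rw [map_add, map_add, map_add],
    fun c z => ⟨starRingEnd ℂ c, by rw [HodgeStructure.conj_smul, map_smul, map_smul, smul_eq_mul]⟩⟩

/-- A non-zero element of a span has a non-zero generator. [folklore] -/
private theorem exists_ne_zero_of_mem_span {M : Type*} [AddCommGroup M] [Module ℂ M] {s : Set M} {x : M}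
    (hx : x ∈ Submodule.span ℂ s) (hx0 : x ≠ 0) : ∃ y ∈ s, y ≠ 0 := by
  by_contra h
  simp only [not_exists, not_and, not_not] at h
  apply hx0
  have hle : Submodule.span ℂ s ≤ ⊥ :=
    Submodule.span_le.mpr fun y hy => by rw [SetLike.mem_coe, Submodule.mem_bot]; exact h y hy
  exact (Submodule.mem_bot ℂ).mp (hle hx)

/-! ### Wedge spans -/

/-- **`W_{ΨΨ'}(Γ) ⊆ F² H²(P_Γ)`**: every wedge of `U_Ψ`-classes is a (2,0)-class (`Fact_pull_hodge`, `Fact_cup2_hodge`). [folklore] -/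
theorem wedgeSpan_le_F_two (hH : U.Fact_pull_hodge) (hcup2 : U.Fact_cup2_hodge) {L : CMField} {ι₁ : L →+* ℂ}
    {V : HermSpace3 L ι₁} (Γ : Level V) (K : CMField) (Ψ Ψ' : CMType K) (σ : K →+* ℂ) :
    U.wedgeSpan Γ K Ψ Ψ' σ ≤ (U.hodge (U.pms L ι₁ V Γ) 2).F 2 := by
  refine Submodule.span_le.mpr ?_
  rintro y ⟨ω₂, ω₃, h₂, h₃, rfl⟩
  exact cup2C_mem_F_two_of_Uiso hH hcup2 Γ K Ψ Ψ' σ h₂ h₃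

/-- **Translate spans lie in wedge spans**: for `ω₀ ∈ U_Ψ(Γ)`, `ω₁ ∈ U_{Ψ'}(Γ)`, every pull-back `g^*(ω₀ ∪ ω₁) = g^*ω₀ ∪ g^*ω₁`
along a morphism `g : P_{Γ'} → P_Γ` is a (ΨΨ')-wedge at level `Γ'` (`Fact_pull_cup`; `U_Ψ` is `Mor`-stable, `Fact_pull_comp`), so
`heckeSpan Γ' Γ (ω₀ ∪ ω₁) ≤ wedgeSpan Γ' Ψ Ψ'`. [folklore] -/
theorem heckeSpan_cup2C_le_wedgeSpan (hc : U.Fact_pull_comp) (hpc : U.Fact_pull_cup) {L : CMField} {ι₁ : L →+* ℂ}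
    {V : HermSpace3 L ι₁} (Γ' Γ : Level V) (K : CMField) (Ψ Ψ' : CMType K) (σ : K →+* ℂ)
    {ω₀ ω₁ : U.CohC (U.pms L ι₁ V Γ) 1} (h₀ : ω₀ ∈ U.Uiso Γ K Ψ σ) (h₁ : ω₁ ∈ U.Uiso Γ K Ψ' σ) :
    U.heckeSpan Γ' Γ (U.cup2C (U.pms L ι₁ V Γ) 1 ω₀ ω₁) ≤ U.wedgeSpan Γ' K Ψ Ψ' σ := by
  refine Submodule.span_le.mpr ?_
  rintro y ⟨g, rfl⟩
  exact Submodule.subset_span ⟨U.pullC g 1 ω₀, U.pullC g 1 ω₁, pullC_mem_Uiso hc g K Ψ σ h₀,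
    pullC_mem_Uiso hc g K Ψ' σ h₁, pullC_cup2C hpc g 1 ω₀ ω₁⟩

/-! ### `FaceWedgeMeet → PeriodThmF` -/

/-- **One meeting class gives the period datum** (any universe with `Fact_pull_hodge`, `Fact_cup2_hodge` and Hodge–Riemann in
bidegree (2,0) on its Picard modular surfaces): `x ≠ 0` lies in `F² H²` (it is a combination of (23)-wedges of `U_Ψ`-classes), so
`tr(x ∪ conj x) ≠ 0` (HR); expanding the left slot over the pure (01)-wedges (ℂ-linear) and then the right slot over the pure
(23)-wedges (conjugate-linear) yields `ω₀, …, ω₃` with `tr((ω₀ ∪ ω₁) ∪ conj(ω₂ ∪ ω₃)) ≠ 0`, which is the period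
(`period_eq_pairing_wedges`); the multilinear expansion `periodNV_of_period_ne_zero` finishes. [folklore] -/
theorem periodNV_of_wedgeMeet (hH : U.Fact_pull_hodge) (hcup2 : U.Fact_cup2_hodge)
    (hHR : ∀ {L : CMField} {ι₁ : L →+* ℂ} {V : HermSpace3 L ι₁} (Γ : Level V) (η : U.CohC (U.pms L ι₁ V Γ) 2),
      η ∈ (U.hodge (U.pms L ι₁ V Γ) 2).F 2 → η ≠ 0 → U.trC (U.pms L ι₁ V Γ) 4 (U.cup2C (U.pms L ι₁ V Γ) 2 η (conj η)) ≠ 0)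
    {L : CMField} {ι₁ : L →+* ℂ} {V : HermSpace3 L ι₁} {K : CMField} {Ψ : Fin 4 → CMType K} {σ : K →+* ℂ}
    (Γ : Level V) {x : U.CohC (U.pms L ι₁ V Γ) 2} (hx0 : x ≠ 0)
    (h01 : x ∈ U.wedgeSpan Γ K (Ψ 0) (Ψ 1) σ) (h23 : x ∈ U.wedgeSpan Γ K (Ψ 2) (Ψ 3) σ) :
    U.PeriodNV ι₁ V K Ψ σ := by
  have hxF : x ∈ (U.hodge (U.pms L ι₁ V Γ) 2).F 2 := wedgeSpan_le_F_two hH hcup2 Γ K (Ψ 2) (Ψ 3) σ h23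
  have hxx : U.trC _ 4 (U.cup2C _ 2 x (conj x)) ≠ 0 := hHR Γ x hxF hx0
  -- expand the LEFT slot over the pure (01)-wedges
  obtain ⟨y, ⟨ω₀, ω₁, h₀, h₁, rfl⟩, hy⟩ := exists_mem_ne_zero_of_span (φ := fun y => U.trC _ 4 (U.cup2C _ 2 y (conj x)))
    (fun y y' => by simp only [map_add, LinearMap.add_apply])
    (fun c y => ⟨c, by simp only [map_smul, LinearMap.smul_apply, smul_eq_mul]⟩) h01 hxx
  -- expand the RIGHT slot over the pure (23)-wedges
  obtain ⟨z, ⟨ω₂, ω₃, h₂, h₃, rfl⟩, hz⟩ :=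
    exists_mem_ne_zero_of_span (φ := fun z => U.trC _ 4 (U.cup2C _ 2 (U.cup2C _ 1 ω₀ ω₁) (conj z)))
      (trC_cup2C_conj_add_smul _ _).1 (trC_cup2C_conj_add_smul _ _).2 h23 hy
  refine periodNV_of_period_ne_zero Γ ![ω₀, ω₁, ω₂, ω₃] (fun i => ?_) ?_
  · match i with
    | 0 => exact h₀
    | 1 => exact h₁
    | 2 => exact h₂
    | 3 => exact h₃
  · rw [period_eq_pairing_wedges]
    simp only [Matrix.cons_val_zero, Matrix.cons_val_one, Matrix.cons_val]
    exact hz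

/-- **`FaceWedgeMeet → PeriodThmF`** on any universe with `Fact_pull_hodge`, `Fact_cup2_hodge` and HR (2,0) on its Picard modular
surfaces. [folklore] -/
theorem periodThmF_of_faceWedgeMeet (hH : U.Fact_pull_hodge) (hcup2 : U.Fact_cup2_hodge)
    (hHR : ∀ {L : CMField} {ι₁ : L →+* ℂ} {V : HermSpace3 L ι₁} (Γ : Level V) (η : U.CohC (U.pms L ι₁ V Γ) 2),
      η ∈ (U.hodge (U.pms L ι₁ V Γ) 2).F 2 → η ≠ 0 → U.trC (U.pms L ι₁ V Γ) 4 (U.cup2C (U.pms L ι₁ V Γ) 2 η (conj η)) ≠ 0)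
    (hM : U.FaceWedgeMeet) : U.PeriodThmF := by
  intro F hG h6 f ι₁ hι V
  obtain ⟨Γ, x, hx0, h01, h23⟩ := hM F hG h6 f ι₁ hι V
  exact periodNV_of_wedgeMeet hH hcup2 hHR Γ hx0 h01 h23

/-! ### The leaf is implied by the splits of record and implies B01-L / B01-S -/

/-- **B01-L ∧ B01-O → FaceWedgeMeet** (`Fact_pull_comp`, `Fact_pull_cup`): the overlap class of a non-zero (01)-wedge lies in the
translate span, which lies in the (01)-wedge span of the deeper level. [folklore] -/
theorem faceWedgeMeet_of_faceLineField_of_wedgeOverlap (hc : U.Fact_pull_comp) (hpc : U.Fact_pull_cup)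
    (hL : U.FaceLineField) (hO : U.FaceWedgeOverlap) : U.FaceWedgeMeet := by
  intro F hG h6 f ι₁ hι V
  obtain ⟨Γ, ω₀, ω₁, h₀, h₁, hne⟩ := hL F hG h6 f ι₁ hι V
  obtain ⟨Γ', x, hx0, hxE, hxW⟩ := hO F hG h6 f ι₁ hι V Γ ω₀ ω₁ h₀ h₁ hne
  exact ⟨Γ', x, hx0, heckeSpan_cup2C_le_wedgeSpan hc hpc Γ' Γ F (f.psi 0) (f.psi 1) ι₁ h₀ h₁ hxE, hxW⟩

/-- **B01-S ∧ B01-H ∧ B01-O → FaceWedgeMeet** (the split of record of `FaceInputsSplit.lean`; `Fact_pull_comp`, `Fact_pull_hodge`,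
`Fact_pull_cup`). [folklore] -/
theorem faceWedgeMeet_of_supply_heckeWedge10_overlap (hc : U.Fact_pull_comp) (hH : U.Fact_pull_hodge)
    (hpc : U.Fact_pull_cup) (hS : U.FaceSupply) (hW : U.HeckeWedge10) (hO : U.FaceWedgeOverlap) : U.FaceWedgeMeet :=
  faceWedgeMeet_of_faceLineField_of_wedgeOverlap hc hpc (faceLineField_of_supply_of_heckeWedge10 hc hH hS hW) hO

/-- **`FaceWedgeMeet → FaceLineField`** (hypothesis-free): a non-zero element of the (01)-wedge span has a non-zero
generator `ω₀ ∪ ω₁`. [folklore] -/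
theorem faceLineField_of_faceWedgeMeet (hM : U.FaceWedgeMeet) : U.FaceLineField := by
  intro F hG h6 f ι₁ hι V
  obtain ⟨Γ, x, hx0, h01, -⟩ := hM F hG h6 f ι₁ hι V
  obtain ⟨y, ⟨ω₀, ω₁, h₀, h₁, rfl⟩, hy⟩ := exists_ne_zero_of_mem_span h01 hx0
  exact ⟨Γ, ω₀, ω₁, h₀, h₁, hy⟩

/-- **`FaceWedgeMeet → FaceSupply`** (hypothesis-free). [folklore] -/
theorem faceSupply_of_faceWedgeMeet (hM : U.FaceWedgeMeet) : U.FaceSupply :=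
  U.faceSupply_of_faceLineField (faceLineField_of_faceWedgeMeet hM)

/-- Over `Fact_pull_comp`, `Fact_pull_cup` and B01-O, the leaf is EQUIVALENT to B01-L. [folklore] -/
theorem faceWedgeMeet_iff_faceLineField_of_wedgeOverlap (hc : U.Fact_pull_comp) (hpc : U.Fact_pull_cup)
    (hO : U.FaceWedgeOverlap) : U.FaceWedgeMeet ↔ U.FaceLineField :=
  ⟨faceLineField_of_faceWedgeMeet, fun hL => faceWedgeMeet_of_faceLineField_of_wedgeOverlap hc hpc hL hO⟩

/-! ### Relation to the target: the PAIRING form is `PeriodThmF` itself; the MEET form is stronger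

`FaceWedgePairing` — at some level a (01)-wedge combination pairs non-trivially with a (23)-wedge combination under
`⟨x, y⟩ := tr(x ∪ conj y)` — is EQUIVALENT to `PeriodThmF` on EVERY universe, with NO hypothesis (expansion of both slots;
conversely a pure quadruple with non-zero period is such a pair).  So the weakest one-line displayed form of B01's
conclusion is `PerLFace` itself; `FaceWedgeMeet` (intersection instead of pairing) implies it under HR (2,0) and is NOT
implied by face theta data without a finite-level generation statement (PerL Lemma 3.5 at fixed level). -/

variable (U) in
/-- **FaceWedgePairing**: for every face datum there are a level `Γ`, a class `x` in the (01)-wedge span and a class `y` in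
the (23)-wedge span with `tr(x ∪ conj y) ≠ 0`.  NOT a new input — `faceWedgePairing_iff_periodThmF` proves it EQUIVALENT to
`PeriodThmF` on every universe; tagged like the other displayed face-scoped Props of `CorCM/B01/` (provable ∕ refutable by name
per universe), asserted by no one. -/
@[conjecture]
def FaceWedgePairing : Prop :=
  ∀ (F : CMField), IsGalois ℚ F → 6 ≤ Module.finrank ℚ F →
    ∀ (f : Face F) (ι₁ : F →+* ℂ), f.Admissible ι₁ →
    ∀ V : HermSpace3 F ι₁, ∃ (Γ : Level V) (x y : U.CohC (U.pms F ι₁ V Γ) 2),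
      x ∈ U.wedgeSpan Γ F (f.psi 0) (f.psi 1) ι₁ ∧ y ∈ U.wedgeSpan Γ F (f.psi 2) (f.psi 3) ι₁ ∧
        U.trC (U.pms F ι₁ V Γ) 4 (U.cup2C (U.pms F ι₁ V Γ) 2 x (conj y)) ≠ 0

/-- **A non-trivially pairing (01)/(23) pair of wedge combinations gives the period datum** — hypothesis-free on every
universe (ℂ-linear expansion of the left slot, conjugate-linear expansion of the right slot, `period_eq_pairing_wedges`,
`periodNV_of_period_ne_zero`). [folklore] -/
theorem periodNV_of_wedgePairing {L : CMField} {ι₁ : L →+* ℂ} {V : HermSpace3 L ι₁} {K : CMField}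
    {Ψ : Fin 4 → CMType K} {σ : K →+* ℂ} (Γ : Level V) {x y : U.CohC (U.pms L ι₁ V Γ) 2}
    (hx : x ∈ U.wedgeSpan Γ K (Ψ 0) (Ψ 1) σ) (hy : y ∈ U.wedgeSpan Γ K (Ψ 2) (Ψ 3) σ)
    (hxy : U.trC (U.pms L ι₁ V Γ) 4 (U.cup2C (U.pms L ι₁ V Γ) 2 x (conj y)) ≠ 0) :
    U.PeriodNV ι₁ V K Ψ σ := by
  obtain ⟨x', ⟨ω₀, ω₁, h₀, h₁, rfl⟩, hx'⟩ := exists_mem_ne_zero_of_span (φ := fun z => U.trC _ 4 (U.cup2C _ 2 z (conj y)))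
    (fun z z' => by simp only [map_add, LinearMap.add_apply])
    (fun c z => ⟨c, by simp only [map_smul, LinearMap.smul_apply, smul_eq_mul]⟩) hx hxy
  obtain ⟨y', ⟨ω₂, ω₃, h₂, h₃, rfl⟩, hy'⟩ :=
    exists_mem_ne_zero_of_span (φ := fun z => U.trC _ 4 (U.cup2C _ 2 (U.cup2C _ 1 ω₀ ω₁) (conj z)))
      (trC_cup2C_conj_add_smul _ _).1 (trC_cup2C_conj_add_smul _ _).2 hy hx'
  refine periodNV_of_period_ne_zero Γ ![ω₀, ω₁, ω₂, ω₃] (fun i => ?_) ?_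
  · match i with
    | 0 => exact h₀
    | 1 => exact h₁
    | 2 => exact h₂
    | 3 => exact h₃
  · rw [period_eq_pairing_wedges]
    simp only [Matrix.cons_val_zero, Matrix.cons_val_one, Matrix.cons_val]
    exact hy'

/-- **`FaceWedgePairing ↔ PeriodThmF` on every universe, hypothesis-free**: the pairing form of the wedge-span statement IS
the face-form period theorem (a pure quadruple with non-zero period is a pairing pair of pure wedges). [folklore] -/
theorem faceWedgePairing_iff_periodThmF : U.FaceWedgePairing ↔ U.PeriodThmF := by
  constructor
  · intro h F hG h6 f ι₁ hι V
    obtain ⟨Γ, x, y, hx, hy, hxy⟩ := h F hG h6 f ι₁ hι V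
    exact periodNV_of_wedgePairing Γ hx hy hxy
  · intro h F hG h6 f ι₁ hι V
    obtain ⟨Γ, Fm, α, hα, hper⟩ := h F hG h6 f ι₁ hι V
    refine ⟨Γ, U.cup2C _ 1 (U.pullC (Fm 0) 1 (α 0)) (U.pullC (Fm 1) 1 (α 1)),
      U.cup2C _ 1 (U.pullC (Fm 2) 1 (α 2)) (U.pullC (Fm 3) 1 (α 3)),
      Submodule.subset_span ⟨_, _, Submodule.subset_span ⟨Fm 0, α 0, hα 0, rfl⟩,
        Submodule.subset_span ⟨Fm 1, α 1, hα 1, rfl⟩, rfl⟩,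
      Submodule.subset_span ⟨_, _, Submodule.subset_span ⟨Fm 2, α 2, hα 2, rfl⟩,
        Submodule.subset_span ⟨Fm 3, α 3, hα 3, rfl⟩, rfl⟩, ?_⟩
    rw [← period_eq_pairing_wedges _ (fun i => U.pullC (Fm i) 1 (α i))]
    exact hper

/-- **MEET ⇒ PAIRING under HR (2,0)** (`x = y` the meeting class, `⟨x, x⟩ ≠ 0`); with `faceWedgePairing_iff_periodThmF` this
re-proves `periodThmF_of_faceWedgeMeet`. [folklore] -/
theorem faceWedgePairing_of_faceWedgeMeet (hH : U.Fact_pull_hodge) (hcup2 : U.Fact_cup2_hodge)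
    (hHR : ∀ {L : CMField} {ι₁ : L →+* ℂ} {V : HermSpace3 L ι₁} (Γ : Level V) (η : U.CohC (U.pms L ι₁ V Γ) 2),
      η ∈ (U.hodge (U.pms L ι₁ V Γ) 2).F 2 → η ≠ 0 → U.trC (U.pms L ι₁ V Γ) 4 (U.cup2C (U.pms L ι₁ V Γ) 2 η (conj η)) ≠ 0)
    (hM : U.FaceWedgeMeet) : U.FaceWedgePairing := by
  intro F hG h6 f ι₁ hι V
  obtain ⟨Γ, x, hx0, h01, h23⟩ := hM F hG h6 f ι₁ hι V
  exact ⟨Γ, x, x, h01, h23, hHR Γ x (wedgeSpan_le_F_two hH hcup2 Γ F (f.psi 2) (f.psi 3) ι₁ h23) hx0⟩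

/-! ### Vacuity discipline: the leaf is false on the PerL shadow -/

variable (U) in
/-- **`FaceWedgeMeet` FAILS on the PerL shadow** of every universe (there `U_Ψ = ⊥` over `ℚ(ζ₇)`, so B01-L fails:
`not_faceLineField_perLShadow`). [folklore] -/
theorem not_faceWedgeMeet_perLShadow : ¬ U.perLShadow.FaceWedgeMeet :=
  fun h => U.not_faceLineField_perLShadow (faceLineField_of_faceWedgeMeet h)

end Universe

/-- **`PerL ∧ PerL44 ∧ ¬ FaceWedgeMeet` is satisfiable, unconditionally** (the PerL shadow of the CM-type universe). [folklore] -/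
theorem exists_perL_perL44_not_faceWedgeMeet : ∃ U : Universe, U.PerL ∧ U.PerL44 ∧ ¬ U.FaceWedgeMeet := by
  obtain ⟨U, hP, h44, hL⟩ := exists_perL_perL44_not_faceLineField
  exact ⟨U, hP, h44, fun h => hL (Universe.faceLineField_of_faceWedgeMeet h)⟩

/-- **`FaceWedgeMeet` is not a universe-uniform consequence of `PerL`, unconditionally.** [folklore] -/
theorem not_forall_perL_imp_faceWedgeMeet : ¬ ∀ U : Universe, U.PerL → U.FaceWedgeMeet := by
  intro h
  obtain ⟨U, hP, -, hM⟩ := exists_perL_perL44_not_faceWedgeMeet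
  exact hM (h U hP)

/-! ### The model universe: HR (2,0) is a theorem, so B01 ⇐ FaceWedgeMeet -/

namespace Model

open Literature.NumberTheory.Automorphic
open Literature.NumberTheory.Automorphic.PicardCM
open Literature.AlgebraicGeometry.HodgeTheory

/-- **`PeriodThmF` of the model universe from `FaceWedgeMeet` alone** (the two facts and HR are tree theorems). [folklore] -/
theorem universeOf_periodThmF_of_faceWedgeMeet (hHD : exists_isReal_hodgeModel) (hI : hodgePQ_independent_of_hodgeModel)
    (hU : BallQuotientUniformisedDatum) (h₃ : CMAbelianVarietyRealised)
    (hM : (universeOf hHD hI hU h₃).FaceWedgeMeet) : (universeOf hHD hI hU h₃).PeriodThmF :=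
  Universe.periodThmF_of_faceWedgeMeet (universeOf_fact_pull_hodge hHD hI hU h₃) (universeOf_fact_cup2_hodge hHD hI hU h₃)
    (fun Γ η hη h0 => universeOf_hodgeRiemann_pms hHD hI hU h₃ _ Γ η hη h0) hM

/-- **Binder B01 BY NAME from the one leaf `FaceWedgeMeet`** demanded at every instance of the model universe; `U.PerL` idle. [folklore] -/
theorem perLFace_of_PerL_of_faceWedgeMeet
    (hM : ∀ (hHD : exists_isReal_hodgeModel) (hI : hodgePQ_independent_of_hodgeModel)
      (h₁ : BallQuotientUniformised) (h₃ : CMAbelianVarietyRealised), (picardCMUniverse hHD hI h₁ h₃).FaceWedgeMeet) :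
    PerLFace_of_PerL :=
  fun hHD hI h₁ h₃ _ => universeOf_periodThmF_of_faceWedgeMeet hHD hI (ballQuotientUniformisedDatum_of h₁) h₃ (hM hHD hI h₁ h₃)

/-- The closed instance: on the model universe OF RECORD the one leaf gives `PerLFace` (= F3's hypothesis). [folklore] -/
theorem perLFace_closed_of_faceWedgeMeet
    (hM : (picardCMUniverse exists_isReal_hodgeModel_holds hodgePQ_independent_of_hodgeModel_holds
      BallQuotient.ballQuotientUniformised_holds cmAbelianVarietyRealised_holds).FaceWedgeMeet) :
    (picardCMUniverse exists_isReal_hodgeModel_holds hodgePQ_independent_of_hodgeModel_holds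
      BallQuotient.ballQuotientUniformised_holds cmAbelianVarietyRealised_holds).PerLFace :=
  universeOf_periodThmF_of_faceWedgeMeet _ _ _ _ hM

/-- On the model universe the one leaf is implied by the three-leaf split of record (all facts tree theorems). [folklore] -/
theorem universeOf_faceWedgeMeet_of_supply_heckeWedge10_overlap (hHD : exists_isReal_hodgeModel)
    (hI : hodgePQ_independent_of_hodgeModel) (hU : BallQuotientUniformisedDatum) (h₃ : CMAbelianVarietyRealised)
    (hS : (universeOf hHD hI hU h₃).FaceSupply) (hW : (universeOf hHD hI hU h₃).HeckeWedge10)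
    (hO : (universeOf hHD hI hU h₃).FaceWedgeOverlap) : (universeOf hHD hI hU h₃).FaceWedgeMeet :=
  Universe.faceWedgeMeet_of_supply_heckeWedge10_overlap (universeOf_fact_pull_comp hHD hI hU h₃)
    (universeOf_fact_pull_hodge hHD hI hU h₃) (universeOf_fact_pull_cup hHD hI hU h₃) hS hW hO

end Model

end Summit.HodgeConjecture.CorCM

end
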